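import Summits.Ventures.PackingBounds.Energy.FivePointRieszSixXData1
import Summits.Ventures.PackingBounds.Energy.FivePointRieszSixXData2
import Summits.Ventures.PackingBounds.Energy.FivePointRieszSixXData3
import Summits.Ventures.PackingBounds.Energy.FivePointRieszSixXData4
import Summits.Ventures.PackingBounds.Energy.FivePointRieszSixXData5
import Summits.Ventures.PackingBounds.Energy.FivePointRieszSixXData6
import Summits.Ventures.PackingBounds.Energy.FivePointRieszSixXData7
import HarnessLib

/-!
# Integer congruence data `X = P (S·Y) Pᵀ` (rows of X: the table (collector of 7 part modules)) for the SOS block of `e3pt-sharp-n3N5s6d8-none.json`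
# (triangular bipyramid; five points on S², single SOS term, d = 8)

Framing: lottery ticket; floor = certified bounds/negative ranges. Venture `PackingBounds`, cell `pub-packcert`, energy family E3PT
(pub-packcert-energy gen 15; n = 3 kernel route). `bR6` = P scaled to integers (`128`·P; rows = the 165 monomials of degree ≤ 8 in
(u,v,t), columns = the 158 face-basis vectors), `xR6` = bR6 · yR6 · bR6ᵀ (165 × 165, exact integers), `scaleXR6` = 128² · S.
Checked by `decide +kernel` with `GramData.checkCongr` in `FivePointRieszSixCongrFacts*`; the slack polynomial of the certificate is
`(1/scaleXR6) · mᵀ xR6 m` for the monomial vector `m` (`FivePointRieszSixSOS`). Generator `pub-packcert-energy/code/e3pt/g15/e3pt_lean_n3x.py`.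
-/

namespace Summit.Ventures.PackingBounds.Energy.RieszSixD8

/-- The scale `128² · S` of `xR6` relative to the certificate's real Gram data. -/
def scaleXR6 : ℤ := 13781435860298007770266671600986612563968

/-- data rows. -/
def xR6 : List (List ℤ) := [xR60, xR61, xR62, xR63, xR64, xR65, xR66, xR67, xR68, xR69, xR610, xR611, xR612, xR613, xR614, xR615, xR616, xR617, xR618, xR619, xR620, xR621, xR622, xR623, xR624, xR625, xR626, xR627, xR628, xR629, xR630, xR631, xR632, xR633, xR634, xR635, xR636, xR637, xR638, xR639, xR640, xR641, xR642, xR643, xR644, xR645, xR646, xR647, xR648, xR649, xR650, xR651, xR652, xR653, xR654, xR655, xR656, xR657, xR658, xR659, xR660, xR661, xR662, xR663, xR664, xR665, xR666, xR667, xR668, xR669, xR670, xR671, xR672, xR673, xR674, xR675, xR676, xR677, xR678, xR679, xR680, xR681, xR682, xR683, xR684, xR685, xR686, xR687, xR688, xR689, xR690, xR691, xR692, xR693, xR694, xR695, xR696, xR697, xR698, xR699, xR6100, xR6101, xR6102, xR6103, xR6104, xR6105, xR6106, xR6107, xR6108, xR6109, xR6110, xR6111, xR6112, xR6113, xR6114,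 xR6115, xR6116, xR6117, xR6118, xR6119, xR6120, xR6121, xR6122, xR6123, xR6124, xR6125, xR6126, xR6127, xR6128, xR6129, xR6130, xR6131, xR6132, xR6133, xR6134, xR6135, xR6136, xR6137, xR6138, xR6139, xR6140, xR6141, xR6142, xR6143, xR6144, xR6145, xR6146, xR6147, xR6148, xR6149, xR6150, xR6151, xR6152, xR6153, xR6154, xR6155, xR6156, xR6157, xR6158, xR6159, xR6160, xR6161, xR6162, xR6163, xR6164]

end Summit.Ventures.PackingBounds.Energy.RieszSixD8
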